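import Summits.Ventures.PercRepro.PairWeighting
import Summits.Ventures.PercRepro.RankLevelSetHClose
import Summits.Ventures.PercRepro.BinomialLayerN
import Summits.Ventures.PercRepro.BinomialLayerD

/-!
# PercRepro — Theorem N, piece (N5): the per-line closing of the pair weighting (p2, gen 5)

`proofs/MINE2-RLS.md` §14 Step 2 (TYPES / THE INEQUALITIES) in the no-truncation form of §15.2, proved with the
CRUDE bounds of Theorem H (no hyperplanes, no skew pairs): for a finite simple matroid `M` with `ρ(E) ≥ p ≥ 4`,
coloop-free when `ρ(E) = p`, and a line `L` with `n′ := |E ∖ L|`,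

* `n′ ≥ p − 1` (`card_sdiff_line_ge`: if `n′ = p − 2` the points of `E ∖ L` are coloops);
* `n′ ≥ p`: every member of `U′_L` is eligible and `F_{n′}(b) ≥ F_p(2) = Φ(p, 2)` (monotonicity in `n` and `b`);
* `n′ = p − 1`: `L ∉ U′_L`; `|L| = 2` gives `U′_L = ∅`; `|L| = 3` gives `U′_L ⊆` the pairs and `L` eligible, closed by
  `u·F(2) + F(3) ≥ u·Φ` (`u ≤ 3`, from `3F(2) + F(3) ≥ 3Φ` and `F(2) ≤ Φ`); `|L| ≥ 4` makes EVERY pair of `L`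
  coindependent (`L ∖ {a, b}` still spans `L`), so `Elig(L)` is all subsets with `≥ 2` points, `#U′_L ≤ 2^ℓ − ℓ − 2`,
  closed by the `D(ℓ)` inequality `Σ_{b=2}^{ℓ} C(ℓ, b)·F(b) ≥ Φ·(2^ℓ − ℓ − 2)` (typer-2's (N2) `D_lemma`,
  `BinomialLayerD.lean`; `perLine_closing` takes it as the hypothesis `hD`, `perLine_closing'` discharges it).

Binomial facts proved here on `ThmN.Fn`: `Fn_eq_F` (typer-2's `F p b = Fn p (p−1) b`), monotonicity in `n` and `b`,
`Fn_two_eq_phiTwo : Fn p p 2 = Φ(p, 2)`, `F_two_le_phiTwo`, `three_phiTwo_le : 3Φ ≤ 3F(2) + F(3)`.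
-/

namespace PercRepro

namespace ThmN

open Finset ThmH BinomialLayer

/-! ### Binomial facts on `Fn` -/

/-- typer-2's `F p b` is `Fn p (p − 1) b`. -/
theorem Fn_eq_F (p b : ℕ) : Fn p (p - 1) b = F p b := rfl

/-- `Fn` is nonnegative. -/
theorem Fn_nonneg (p n b : ℕ) : 0 ≤ Fn p n b := by
  unfold Fn
  apply Finset.sum_nonneg
  intro x _
  positivity

/-- `Fn p n b` is monotone in `n`. -/
theorem Fn_mono_n {n n' : ℕ} (h : n ≤ n') (p b : ℕ) : Fn p n b ≤ Fn p n' b := by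
  unfold Fn
  apply Finset.sum_le_sum
  intro x _
  have : (n.choose x : ℚ) ≤ (n'.choose x : ℚ) := by exact_mod_cast Nat.choose_le_choose x h
  have h2 : (0 : ℚ) ≤ (b.choose 2 : ℚ) / ((b + x).choose 2 : ℚ) := by positivity
  rw [mul_div_assoc, mul_div_assoc]
  exact mul_le_mul_of_nonneg_right this h2

/-- The ratio `C(b, 2)/C(b + x, 2)` is nondecreasing in `b` for `b ≥ 2`. -/
theorem choose_ratio_mono (b x : ℕ) (hb : 2 ≤ b) :
    (b.choose 2 : ℚ) / ((b + x).choose 2 : ℚ) ≤ ((b + 1).choose 2 : ℚ) / ((b + 1 + x).choose 2 : ℚ) := by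
  rw [Nat.cast_choose_two, Nat.cast_choose_two, Nat.cast_choose_two, Nat.cast_choose_two]
  push_cast
  have hb' : (2 : ℚ) ≤ b := by exact_mod_cast hb
  have hx' : (0 : ℚ) ≤ x := by exact_mod_cast Nat.zero_le x
  have hpos1 : (0 : ℚ) < ((b : ℚ) + x) * ((b : ℚ) + x - 1) / 2 := by
    apply div_pos _ (by norm_num)
    apply mul_pos <;> linarith
  have hpos2 : (0 : ℚ) < ((b : ℚ) + 1 + x) * ((b : ℚ) + 1 + x - 1) / 2 := by
    apply div_pos _ (by norm_num)
    apply mul_pos <;> linarith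
  rw [div_le_div_iff₀ hpos1 hpos2]
  have hbx : (0 : ℚ) ≤ (b : ℚ) * ((b : ℚ) + x) := by positivity
  nlinarith [mul_nonneg hbx hx']

/-- `Fn p n b` is monotone in `b` for `b ≥ 2`. -/
theorem Fn_mono_b {b b' : ℕ} (hb : 2 ≤ b) (h : b ≤ b') (p n : ℕ) : Fn p n b ≤ Fn p n b' := by
  induction b', h using Nat.le_induction with
  | base => exact le_refl _
  | succ c hc ih =>
    refine ih.trans ?_
    unfold Fn
    apply Finset.sum_le_sum
    intro x _
    rw [mul_div_assoc, mul_div_assoc]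
    exact mul_le_mul_of_nonneg_left (choose_ratio_mono c x (by omega)) (by positivity)

/-- `F_p(2) = Φ(p, 2)`: `C(p, x)/C(x + 2, 2) = C(p + 2, x + 2)/C(p + 2, 2)`. -/
theorem Fn_two_eq_phiTwo (p : ℕ) (hp : 3 ≤ p) : Fn p p 2 = phiTwo p := by
  unfold Fn phiTwo
  rw [choose_add_two_self, Finset.sum_div]
  have himg : Finset.Ioo 2 p = (Finset.Ico 1 (p - 2)).image (fun x => x + 2) := by
    ext u
    simp only [Finset.mem_Ioo, Finset.mem_image, Finset.mem_Ico]
    constructor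
    · intro h; exact ⟨u - 2, ⟨by omega, by omega⟩, by omega⟩
    · rintro ⟨x, hx, rfl⟩; omega
  rw [himg, Finset.sum_image (fun x _ y _ h => by simpa using h)]
  apply Finset.sum_congr rfl
  intro x _
  rw [Nat.choose_self, Nat.cast_one, mul_one, show 2 + x = x + 2 by omega]
  have hpos : (0 : ℚ) < ((x + 2).choose 2 : ℚ) := by exact_mod_cast Nat.choose_pos (by omega)
  have hpos2 : (0 : ℚ) < ((p + 2).choose 2 : ℚ) := by exact_mod_cast Nat.choose_pos (by omega)
  have key : ((p + 2).choose (x + 2) : ℚ) * ((x + 2).choose 2 : ℚ) = ((p + 2).choose 2 : ℚ) * (p.choose x : ℚ) := by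
    have := Nat.choose_mul (n := p + 2) (k := x + 2) (s := 2) (by omega)
    rw [show p + 2 - 2 = p by omega, show x + 2 - 2 = x by omega] at this
    exact_mod_cast this
  rw [div_eq_div_iff hpos.ne' hpos2.ne']
  linarith [key]

/-- `F(p, 2) ≤ Φ(p, 2)` (`F_{p−1}(2) ≤ F_p(2) = Φ`). -/
theorem F_two_le_phiTwo (p : ℕ) (hp : 4 ≤ p) : F p 2 ≤ phiTwo p := by
  rw [← Fn_eq_F, ← Fn_two_eq_phiTwo p (by omega)]
  exact Fn_mono_n (by omega) p 2

/-- `3Φ(p, 2) ≤ 3F(p, 2) + F(p, 3)` (mine-2: the difference is `2(p − 3)/p`). -/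
theorem three_phiTwo_le (p : ℕ) (hp : 4 ≤ p) : 3 * phiTwo p ≤ 3 * F p 2 + F p 3 := by
  obtain ⟨m, rfl⟩ : ∃ m, p = m + 4 := ⟨p - 4, by omega⟩
  have h2 := F_two_mul m
  have h3 := F_three_mul m
  have hphi := phiTwo_mul m
  have hD := D_pos m
  have key : (3 * F (m + 4) 2 + F (m + 4) 3 - 3 * phiTwo (m + 4)) * D m =
      2 * ((m : ℚ) + 1) * (m + 5) * (m + 6) * (m + 7) := by
    have e : (3 * F (m + 4) 2 + F (m + 4) 3 - 3 * phiTwo (m + 4)) * D m =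
        3 * (F (m + 4) 2 * D m) + F (m + 4) 3 * D m - 3 * (phiTwo (m + 4) * D m) := by ring
    rw [e, h2, h3, hphi]
    ring
  have hnn : 0 ≤ (3 * F (m + 4) 2 + F (m + 4) 3 - 3 * phiTwo (m + 4)) * D m := by
    rw [key]; positivity
  have := nonneg_of_mul_D hnn
  linarith

/-! ### The matroid side -/

section Matroid

variable {α : Type*} [DecidableEq α] {M : Matroid α} [M.Finite]

omit [DecidableEq α] in
/-- The rank of a finset is a natural number bounded by its size. -/
theorem exists_nat_eRk (M : Matroid α) [M.Finite] (X : Finset α) :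
    ∃ k : ℕ, M.eRk (X : Set α) = k ∧ k ≤ X.card := by
  have h := M.eRk_le_encard (X : Set α)
  rw [Set.encard_coe_eq_coe_finsetCard] at h
  have hne : M.eRk (X : Set α) ≠ ⊤ := ne_top_of_le_ne_top (ENat.coe_ne_top _) h
  obtain ⟨k, hk⟩ := ENat.ne_top_iff_exists.1 hne
  refine ⟨k, hk.symm, ?_⟩
  rw [← hk] at h
  exact_mod_cast h

/-- `ρ(E) ≤ ρ(E ∖ L) + 2` for a line `L` (submodularity). -/
theorem eRank_le_eRk_sdiff_add_two {L : Finset α} (hL : L ∈ lines M) :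
    M.eRank ≤ M.eRk ((gr M \ L : Finset α) : Set α) + 2 := by
  have hLE := (mem_lines.1 hL).1
  have hsplit : gr M = (gr M \ L) ∪ L := (Finset.sdiff_union_of_subset hLE).symm
  have h := M.eRk_union_le_eRk_add_eRk ((gr M \ L : Finset α) : Set α) (L : Set α)
  rw [← Finset.coe_union, ← hsplit, coe_gr, M.eRk_ground, (mem_lines.1 hL).2.2] at h
  exact h

/-- **`n′ ≥ p − 1`**: for `ρ(E) ≥ p`, coloop-free when `ρ(E) = p`, every line has `|E ∖ L| ≥ p − 1`
(if `|E ∖ L| = p − 2` then `ρ(E) = p`, `E ∖ L` is independent and skew to `L`, and its points are coloops). -/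
theorem card_sdiff_line_ge {p : ℕ} (hp4 : 4 ≤ p) (hpE : ((p : ℕ) : ℕ∞) ≤ M.eRank)
    (hcol : M.eRank = (p : ℕ) → ∀ e, ¬ M.IsColoop e) {L : Finset α} (hL : L ∈ lines M) :
    p - 1 ≤ (gr M \ L).card := by
  have hLE := (mem_lines.1 hL).1
  obtain ⟨k, hk, hkn⟩ := exists_nat_eRk M (gr M \ L)
  have h1 := eRank_le_eRk_sdiff_add_two hL
  rw [hk] at h1
  have h1' : ((p : ℕ) : ℕ∞) ≤ ((k + 2 : ℕ) : ℕ∞) := by push_cast; exact hpE.trans h1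
  have h1n : p ≤ k + 2 := by exact_mod_cast h1'
  by_contra hcon
  push Not at hcon
  -- then k = p − 2 = |E ∖ L|, ρ(E) = p, and every point of E ∖ L is a coloop
  have hk2 : k = p - 2 := by omega
  have hn : (gr M \ L).card = p - 2 := by omega
  have hR : M.eRank = (p : ℕ) := by
    apply le_antisymm _ hpE
    calc M.eRank ≤ (k : ℕ∞) + 2 := h1
      _ = ((p : ℕ) : ℕ∞) := by rw [hk2]; norm_cast; omega
  obtain ⟨e, he⟩ : ∃ e, e ∈ gr M \ L := Finset.card_pos.1 (by omega)
  apply hcol hR e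
  rw [Matroid.isColoop_iff_sdiff_not_spanning, Matroid.spanning_iff_eRk_le Set.sdiff_subset, hR]
  -- ρ(E ∖ {e}) ≤ ρ(E ∖ L ∖ {e}) + 2 ≤ (p − 3) + 2 < p
  have heE : e ∈ gr M := (Finset.mem_sdiff.1 he).1
  have hsplit : M.E \ {e} = (((gr M \ L).erase e : Finset α) : Set α) ∪ (L : Set α) := by
    rw [← coe_gr M, ← Finset.coe_union, ← Finset.coe_erase]
    congr 1
    ext y
    simp only [Finset.mem_erase, Finset.mem_union, Finset.mem_sdiff]
    constructor
    · rintro ⟨hye, hy⟩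
      by_cases hyL : y ∈ L
      · exact Or.inr hyL
      · exact Or.inl ⟨hye, hy, hyL⟩
    · rintro (⟨hye, hy, -⟩ | hyL)
      · exact ⟨hye, hy⟩
      · refine ⟨?_, hLE hyL⟩
        rintro rfl
        exact (Finset.mem_sdiff.1 he).2 hyL
  have h2 := M.eRk_union_le_eRk_add_eRk ((((gr M \ L).erase e : Finset α)) : Set α) (L : Set α)
  rw [← hsplit, (mem_lines.1 hL).2.2] at h2
  obtain ⟨j, hj, hjn⟩ := exists_nat_eRk M ((gr M \ L).erase e)
  rw [Finset.card_erase_of_mem he, hn] at hjn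
  rw [hj] at h2
  intro hcontra
  have h3 : ((p : ℕ) : ℕ∞) ≤ ((j + 2 : ℕ) : ℕ∞) := by push_cast; exact hcontra.trans h2
  have h3n : p ≤ j + 2 := by exact_mod_cast h3
  omega

/-- When `|E ∖ L| < p`, `L` itself is not in `U′_L`. -/
theorem line_notMem_UpL {p : ℕ} {L : Finset α} (hn : (gr M \ L).card < p) : L ∉ UpL M p L := by
  intro hL
  simp only [UpL, Finset.mem_filter, Finset.mem_powerset] at hL
  obtain ⟨-, -, hr⟩ := hL
  obtain ⟨k, hk, hkn⟩ := exists_nat_eRk M (gr M \ L)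
  rw [hk] at hr
  have : p ≤ k := by exact_mod_cast hr
  omega

/-- On a line with at least four points every pair is coindependent: `L ∖ {a, b}` still spans `L`, so
`cl(E ∖ {a, b}) = E`. -/
theorem coindep_of_four_le (hs : Simple M) {p : ℕ} (hpE : ((p : ℕ) : ℕ∞) ≤ M.eRank) {L : Finset α}
    (hL : L ∈ lines M) (hℓ : 4 ≤ L.card) {a b : α} (ha : a ∈ L) (hb : b ∈ L) (hab : a ≠ b) :
    Coindep M p a b := by
  have hLE := (mem_lines.1 hL).1
  unfold Coindep
  -- the two remaining points of L span L
  set B := (L.erase a).erase b with hB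
  have hBL : B ⊆ L := (Finset.erase_subset _ _).trans (Finset.erase_subset _ _)
  have hBc : 2 ≤ B.card := by
    rw [hB, Finset.card_erase_of_mem (Finset.mem_erase.2 ⟨hab.symm, hb⟩), Finset.card_erase_of_mem ha]
    omega
  have hcl := closure_eq_of_subset_line hL hBL (eRk_eq_two_of_subset_line hs hL hBL hBc)
  have hBsub : (B : Set α) ⊆ ((gr M \ {a, b} : Finset α) : Set α) := by
    apply Finset.coe_subset.2
    intro y hy
    rw [hB, Finset.mem_erase, Finset.mem_erase] at hy
    rw [Finset.mem_sdiff, Finset.mem_insert, Finset.mem_singleton]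
    exact ⟨hLE hy.2.2, by rintro (rfl | rfl) <;> simp_all⟩
  have hLcl : (L : Set α) ⊆ M.closure ((gr M \ {a, b} : Finset α) : Set α) := by
    rw [← hcl]
    exact M.closure_subset_closure hBsub
  have hEcl : M.E ⊆ M.closure ((gr M \ {a, b} : Finset α) : Set α) := by
    intro y hy
    by_cases hyL : y ∈ L
    · exact hLcl hyL
    · apply M.subset_closure _ (by rw [← coe_gr M]; exact Finset.coe_subset.2 Finset.sdiff_subset)
      rw [Finset.mem_coe, Finset.mem_sdiff, Finset.mem_insert, Finset.mem_singleton]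
      refine ⟨by rw [← coe_gr M] at hy; exact_mod_cast hy, ?_⟩
      rintro (rfl | rfl)
      · exact hyL ha
      · exact hyL hb
  rw [← M.eRk_closure_eq, Matroid.eRk_eq_eRank hEcl]
  exact hpE

/-- On a line with at least four points the eligible subsets are all subsets with at least two points. -/
theorem Elig_eq_of_four_le (hs : Simple M) {p : ℕ} (hpE : ((p : ℕ) : ℕ∞) ≤ M.eRank) {L : Finset α}
    (hL : L ∈ lines M) (hℓ : 4 ≤ L.card) :
    Elig M p L = L.powerset.filter (fun B => 2 ≤ B.card) := by
  classical
  ext B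
  simp only [Elig, Finset.mem_filter, Finset.mem_powerset]
  constructor
  · rintro ⟨hBL, hB2, -⟩; exact ⟨hBL, hB2⟩
  · rintro ⟨hBL, hB2⟩
    refine ⟨hBL, hB2, ?_⟩
    obtain ⟨a, ha, b, hb, hab⟩ := Finset.one_lt_card.1 (show 1 < B.card by omega)
    exact ⟨a, ha, b, hb, hab, coindep_of_four_le hs hpE hL hℓ (hBL ha) (hBL hb) hab⟩

/-- When `|E ∖ L| < p`: `#U′_L + 1 ≤ #{B ⊆ L : 2 ≤ |B|}` (`L` is excluded). -/
theorem card_UpL_add_one_le {p : ℕ} {L : Finset α} (hL : L ∈ lines M) (hn : (gr M \ L).card < p) :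
    (UpL M p L).card + 1 ≤ (L.powerset.filter (fun B => 2 ≤ B.card)).card := by
  have hLmem : L ∈ L.powerset.filter (fun B => 2 ≤ B.card) := by
    simp only [Finset.mem_filter, Finset.mem_powerset]
    exact ⟨subset_refl _, two_le_card_of_mem_lines hL⟩
  have hsub : UpL M p L ⊆ (L.powerset.filter (fun B => 2 ≤ B.card)).erase L := by
    intro B hB
    rw [Finset.mem_erase]
    refine ⟨?_, ?_⟩
    · rintro rfl; exact line_notMem_UpL hn hB
    · simp only [UpL, Finset.mem_filter, Finset.mem_powerset] at hB ⊢
      exact ⟨hB.1, hB.2.1⟩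
  have := Finset.card_le_card hsub
  rw [Finset.card_erase_of_mem hLmem] at this
  have hpos : 1 ≤ (L.powerset.filter (fun B => 2 ≤ B.card)).card := Finset.card_pos.2 ⟨L, hLmem⟩
  omega

end Matroid

end ThmN

end PercRepro
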